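import Summits.HubbardSuperconductivity.HubbardSuperconductivity.Theorems.AnisotropyChordKnnComparison
import Summits.HubbardSuperconductivity.HubbardSuperconductivity.Theorems.AnisotropyChordKnnBlock

/-!
# Route `AnisotropyChord` / H0 rotor rung, K_{n,n} sibling of XY-LM₀: TOP SECTORS and the `M ↦ −M` symmetry
(prover seat `hubbard-h0-rotor-p1` g13; Lean port of the trivial part of theory seat THEOREM Q, THEOREMS M13)

* `casimirMean_le_top_value`: `⟨J(J+1)⟩ ≤ 2s(2s+1)` in every state of every block (`|M| ≤ 2s`);
* `numLevels_eq_one`, `casimirMean_eq_top_value`: for `|M| ∈ {2s−1, 2s}` the block is `1 × 1` on the level `J = 2s`, so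
  `⟨J(J+1)⟩ = 2s(2s+1)` — the links into the two top sectors of `XYLiebMattisKnn` hold for free (`g(2s−1) = g(2s)`);
* `casimirMean_eq_of_natAbs_eq`: the blocks of `M` and `M'` with `|M| = |M'|` coincide (they depend on `|M|`, `M²` only), so
  by Perron uniqueness their top vectors have the same `⟨J(J+1)⟩` (transport along `Fin.cast` + `isTopVector_unique`).
-/

set_option linter.dupNamespace false
set_option autoImplicit false

noncomputable section

open Finset Matrix

namespace Summit.HubbardSuperconductivity.HubbardSuperconductivity.Theorems.AnisotropyChord.Knn

/-! ## Norms in sequence form -/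

/-- `Σ_{k<m} (ext0 x k)² = ⟨x, x⟩`. [folklore] -/
theorem sum_range_ext0_sq {m : ℕ} (x : Fin m → ℝ) : ∑ k ∈ range m, ext0 x k ^ 2 = x ⬝ᵥ x := by
  have h : x ⬝ᵥ x = ∑ k : Fin m, ext0 x k * x k := by
    simp only [dotProduct, ext0_fin]
  rw [h, sum_fin_eq_sum_range_ext0 x (ext0 x)]
  apply Finset.sum_congr rfl; intro k _; ring

/-- `Σ_{k<m} (ext0 x k)² > 0` for `x ≠ 0`. [folklore] -/
theorem sum_range_ext0_sq_pos {m : ℕ} {x : Fin m → ℝ} (hx : x ≠ 0) : 0 < ∑ k ∈ range m, ext0 x k ^ 2 := by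
  rw [sum_range_ext0_sq]; exact dotProduct_self_pos_of_ne_zero hx

/-- `ext0 (t • x) = t · ext0 x`. [folklore] -/
theorem ext0_smul {m : ℕ} (t : ℝ) (x : Fin m → ℝ) (k : ℕ) : ext0 (t • x) k = t * ext0 x k := by
  unfold ext0; split_ifs <;> simp

/-! ## The top value `2s(2s+1)` -/

/-- **`⟨J(J+1)⟩ ≤ 2s(2s+1)`** in every non-zero state of the block `P_M`, `|M| ≤ 2s`. [folklore] -/
theorem casimirMean_le_top_value {twoS : ℕ} {M : ℤ} (hM : M.natAbs ≤ twoS)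
    {x : Fin (numLevels twoS M) → ℝ} (hx : x ≠ 0) :
    casimirMean twoS M x ≤ (twoS : ℝ) * ((twoS : ℝ) + 1) := by
  rw [casimirMean_eq, div_le_iff₀ (sum_range_ext0_sq_pos hx), Finset.mul_sum]
  apply Finset.sum_le_sum
  intro k hk
  exact mul_le_mul_of_nonneg_right (fK_le_top twoS hM (mem_range.mp hk)) (sq_nonneg _)

/-- the two top sectors `|M| ∈ {2s−1, 2s}` have a single level. [folklore] -/
theorem numLevels_eq_one {twoS : ℕ} {M : ℤ} (hM : M.natAbs ≤ twoS) (htop : twoS ≤ M.natAbs + 1) :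
    numLevels twoS M = 1 := by
  have h1 := jMin_mod_two twoS M
  have h2 := natAbs_le_jMin twoS M
  have h3 := jMin_le twoS hM
  have h4 := jMin_le_natAbs_succ twoS M
  unfold numLevels; omega

/-- … and that level is `J = 2s`. [folklore] -/
theorem lev_zero_of_top {twoS : ℕ} {M : ℤ} (hM : M.natAbs ≤ twoS) (htop : twoS ≤ M.natAbs + 1) :
    lev twoS M 0 = twoS := by
  have h := lev_top twoS hM
  rwa [numLevels_eq_one hM htop] at h

/-- **`⟨J(J+1)⟩ = 2s(2s+1)`** in every non-zero state of the top sectors `|M| ∈ {2s−1, 2s}` (THEOREM Q: `g(2s−1) = g(2s)`).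
[conjecture: theory seat hubbard-h0-rotor-theory-1, cycle 11 — THEOREM Q (M13), trivial part; Lean proof here] -/
theorem casimirMean_eq_top_value {twoS : ℕ} {M : ℤ} (hM : M.natAbs ≤ twoS) (htop : twoS ≤ M.natAbs + 1)
    {x : Fin (numLevels twoS M) → ℝ} (hx : x ≠ 0) :
    casimirMean twoS M x = (twoS : ℝ) * ((twoS : ℝ) + 1) := by
  have hpos := sum_range_ext0_sq_pos hx
  rw [casimirMean_eq] at ⊢
  simp only [numLevels_eq_one hM htop, Finset.sum_range_one] at hpos ⊢
  have hf : fK twoS M 0 = (twoS : ℝ) * ((twoS : ℝ) + 1) := by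
    unfold fK; rw [lev_zero_of_top hM htop]
  rw [hf, mul_div_assoc, div_self hpos.ne', mul_one]

/-- Hence every link INTO a top sector holds: `casimirMean(M) ≤ casimirMean(M')` for `|M'| ∈ {2s−1, 2s}`. [folklore] -/
theorem casimirMean_le_of_top {twoS : ℕ} {M M' : ℤ} (hM : M.natAbs ≤ twoS) (hM' : M'.natAbs ≤ twoS)
    (htop : twoS ≤ M'.natAbs + 1) {x : Fin (numLevels twoS M) → ℝ} {x' : Fin (numLevels twoS M') → ℝ}
    (hx : x ≠ 0) (hx' : x' ≠ 0) : casimirMean twoS M x ≤ casimirMean twoS M' x' := by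
  rw [casimirMean_eq_top_value hM' htop hx']
  exact casimirMean_le_top_value hM hx

/-! ## Transport along `Fin.cast` and the `M ↦ −M` symmetry -/

/-- a top vector of `jac m' p c` re-indexed along `m' = m`. [folklore] -/
theorem isTopVector_cast {m m' : ℕ} (h : m' = m) {p c : ℕ → ℝ} {x' : Fin m' → ℝ}
    (hx' : IsTopVector (jac m' p c) x') : IsTopVector (jac m p c) (fun k => x' (Fin.cast h.symm k)) := by
  subst h; exact hx'

/-- `ext0` is unchanged by re-indexing along `m' = m`. [folklore] -/
theorem ext0_comp_cast {m m' : ℕ} (h : m' = m) (x' : Fin m' → ℝ) :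
    ext0 (fun k : Fin m => x' (Fin.cast h.symm k)) = ext0 x' := by
  subst h; rfl

/-- `(M')² = M²` when `|M| = |M'|`. [folklore] -/
theorem sq_cast_eq_of_natAbs_eq {M M' : ℤ} (h : M.natAbs = M'.natAbs) : (M : ℝ) ^ 2 = (M' : ℝ) ^ 2 := by
  rcases Int.natAbs_eq_natAbs_iff.mp h with h1 | h1
  · rw [h1]
  · rw [h1]; push_cast; ring

/-- `jMin` depends on `|M|` only. [folklore] -/
theorem jMin_eq_of_natAbs_eq (twoS : ℕ) {M M' : ℤ} (h : M.natAbs = M'.natAbs) : jMin twoS M = jMin twoS M' := by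
  unfold jMin; rw [h]

/-- `numLevels` depends on `|M|` only. [folklore] -/
theorem numLevels_eq_of_natAbs_eq (twoS : ℕ) {M M' : ℤ} (h : M.natAbs = M'.natAbs) :
    numLevels twoS M = numLevels twoS M' := by
  unfold numLevels; rw [jMin_eq_of_natAbs_eq twoS h]

/-- `lev` depends on `|M|` only. [folklore] -/
theorem lev_eq_of_natAbs_eq (twoS : ℕ) {M M' : ℤ} (h : M.natAbs = M'.natAbs) : lev twoS M = lev twoS M' := by
  funext k; unfold lev; rw [jMin_eq_of_natAbs_eq twoS h]

/-- `bSq` depends on `|M|` only. [folklore] -/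
theorem bSq_eq_of_natAbs_eq (twoS : ℕ) {M M' : ℤ} (h : M.natAbs = M'.natAbs) : bSq twoS M = bSq twoS M' := by
  funext J; unfold bSq; rw [sq_cast_eq_of_natAbs_eq h]

/-- `bSqPred` depends on `|M|` only. [folklore] -/
theorem bSqPred_eq_of_natAbs_eq (twoS : ℕ) {M M' : ℤ} (h : M.natAbs = M'.natAbs) :
    bSqPred twoS M = bSqPred twoS M' := by
  funext J; unfold bSqPred; rw [bSq_eq_of_natAbs_eq twoS h]

/-- `pK` depends on `|M|` only. [folklore] -/
theorem pK_eq_of_natAbs_eq (twoS : ℕ) {M M' : ℤ} (h : M.natAbs = M'.natAbs) (η : ℝ) :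
    pK twoS M η = pK twoS M' η := by
  funext k; unfold pK
  rw [lev_eq_of_natAbs_eq twoS h, bSq_eq_of_natAbs_eq twoS h, bSqPred_eq_of_natAbs_eq twoS h]

/-- `cK` depends on `|M|` only. [folklore] -/
theorem cK_eq_of_natAbs_eq (twoS : ℕ) {M M' : ℤ} (h : M.natAbs = M'.natAbs) (η : ℝ) :
    cK twoS M η = cK twoS M' η := by
  funext k; unfold cK; rw [lev_eq_of_natAbs_eq twoS h, bSq_eq_of_natAbs_eq twoS h]

/-- `fK` depends on `|M|` only. [folklore] -/
theorem fK_eq_of_natAbs_eq (twoS : ℕ) {M M' : ℤ} (h : M.natAbs = M'.natAbs) : fK twoS M = fK twoS M' := by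
  funext k; unfold fK; rw [lev_eq_of_natAbs_eq twoS h]

/-- the `e²`-weighted mean is scale invariant. [folklore] -/
theorem mean_smul_invariant (m : ℕ) (f : ℕ → ℝ) {t : ℝ} (ht : t ≠ 0) (x : Fin m → ℝ) :
    (∑ k ∈ range m, f k * ext0 (t • x) k ^ 2) / (∑ k ∈ range m, ext0 (t • x) k ^ 2)
      = (∑ k ∈ range m, f k * ext0 x k ^ 2) / (∑ k ∈ range m, ext0 x k ^ 2) := by
  have h1 : ∑ k ∈ range m, f k * ext0 (t • x) k ^ 2 = t ^ 2 * ∑ k ∈ range m, f k * ext0 x k ^ 2 := by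
    rw [Finset.mul_sum]; apply Finset.sum_congr rfl; intro k _; rw [ext0_smul]; ring
  have h2 : ∑ k ∈ range m, ext0 (t • x) k ^ 2 = t ^ 2 * ∑ k ∈ range m, ext0 x k ^ 2 := by
    rw [Finset.mul_sum]; apply Finset.sum_congr rfl; intro k _; rw [ext0_smul]; ring
  rw [h1, h2, mul_div_mul_left _ _ (pow_ne_zero 2 ht)]

/-- **`M ↦ −M` symmetry (and Perron uniqueness): top vectors of the blocks of `M` and `M'` with `|M| = |M'|` have the
same `⟨J(J+1)⟩`** (`η > 0`, `|M| ≤ 2s`). [folklore] -/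
theorem casimirMean_eq_of_natAbs_eq {twoS : ℕ} {M M' : ℤ} (h : M.natAbs = M'.natAbs) (hM : M.natAbs ≤ twoS)
    {η : ℝ} (hη : 0 < η) {x : Fin (numLevels twoS M) → ℝ} {x' : Fin (numLevels twoS M') → ℝ}
    (hx : IsTopVector (knnBlock twoS M η) x) (hx' : IsTopVector (knnBlock twoS M' η) x') :
    casimirMean twoS M x = casimirMean twoS M' x' := by
  rw [knnBlock_eq_jac] at hx hx'
  have hn : numLevels twoS M = numLevels twoS M' := numLevels_eq_of_natAbs_eq twoS h
  rw [← pK_eq_of_natAbs_eq twoS h, ← cK_eq_of_natAbs_eq twoS h] at hx'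
  have hx'' := isTopVector_cast hn.symm hx'
  have hc : ∀ k, k + 1 < numLevels twoS M → 0 < cK twoS M η k := fun k hk => cK_pos hM hη hk
  obtain ⟨t, ht, hxt⟩ := isTopVector_unique hc hx hx''
  rw [casimirMean_eq, casimirMean_eq, ← fK_eq_of_natAbs_eq twoS h, ← ext0_comp_cast hn.symm x', hxt, ← hn]
  exact (mean_smul_invariant _ _ ht.ne' x).symm

end Summit.HubbardSuperconductivity.HubbardSuperconductivity.Theorems.AnisotropyChord.Knn
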